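import Mathlib
import Literature.NumberTheory.GaloisRepresentations.GaloisRep
import Literature.NumberTheory.GaloisRepresentations.CubicResidueSymbol
import Literature.NumberTheory.GaloisRepresentations.SteinbergArtinRep
import Literature.FieldTheory.AlgClosed.PadicAlgClEquivComplex
import Literature.NumberTheory.QuadraticForms.HilbertReciprocityFiniteness
import Literature.NumberTheory.GaloisRepresentations.SuperellipticPicGaloisModule
import Literature.RepresentationTheory.Semisimple.SubrepresentationEquiv
import HarnessLib

/-!
# PicardCurveGaloisRep

Topic `Literature/NumberTheory/GaloisRepresentations`. Named literature fact(s) relocated by the gate from `Summits/Langlands/Langlands/Theorems/PicardMuOrdinaryMuOrdinaryFamilyRTPicardInput.lean`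
(accept-time relocation of `[cite]`d propositions written inline in a Summits proposal; human ruling 2026-08-15).
Sources: DeligneSGA4half1977, IrelandRosen1982, PoonenSchaefer1997, Schaefer1998, SerreTate1968GoodReduction, Upton2009, Zarhin2018SuperellipticJacobians.

* `Literature.NumberTheory.GaloisRepresentations.picardCurve_exists_lambdaAdicRep`

## Proved ingredients of the printed argument (partial progress towards `_holds`)

Two of the elementary steps named in the docstring of the fact are proved below, in the tree's
vocabulary, for use by an eventual discharge:

* (FROBENIUS TRACE, fibre count) `picard_card_affinePoints`: for `𝔭 ∤ 3`,
  `#{(x, y) ∈ k_𝔭² : y³ = f̄(x)} = N𝔭 - a_𝔭(f) - a_𝔭(f²)` in `𝓞 K`, where `a_𝔭 = picardTrace` and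
  `a_𝔭(f²) = -Σ_x χ_𝔭(f̄(x))²` is the conjugate character sum `-S_χ̄` (Ireland–Rosen Prop. 8.1.5:
  `N(y³ = a) = 1 + χ(a) + χ(a)²`, proved as `card_subtype_pow_three_eq`); with the point at infinity
  this is `#C_f(k_𝔭) = N𝔭 + 1 + S_χ + S_χ̄`.
* (RESIDUAL IRREDUCIBILITY, the module `(F⁴)⁰`) `augmentationRep_isIrreducible_of_alternatingGroup_le`:
  over any field of characteristic `≠ 2`, the augmentation (sum-zero) representation of a `G`-set
  with `4` elements on which `G` induces at least the alternating group is irreducible — hence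
  `(𝔽₃^{roots f})⁰ ⊗ F` is irreducible for every field `F ⊇ 𝔽₃` once the Galois image contains `A₄`.
* (RESIDUAL IRREDUCIBILITY, the Galois image) `alternatingGroup_le_range_toPermHom_rootSet`: for
  `12 ∣ #Gal(f/ℚ)` the image of `Γ_K` (`K` any model of `ℚ(ω)`) in the permutations of the four roots
  of `f` in `K̄` contains the alternating group (`Gal(f/ℚ) ⊇ A₄`, and `σ² ∈ Γ_K` for every
  `σ ∈ Gal(K̄/ℚ)` as `[K : ℚ] = 2`); whence `augmentationRep_rootSet_isIrreducible`: the augmentation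
  representation of `Γ_K` on `(k^{roots f})⁰` is irreducible for EVERY field `k` of characteristic
  `≠ 2` — the Schaefer–Zarhin module `(𝔽₃^{R_f})⁰ ≅ J_f[1 - ω]` (Zarhin 2018 §8 (i)) is absolutely
  irreducible.  Only the geometric comparison `ρ̄ ≅ (𝔽₃^{R_f})⁰ ⊗ 𝔽̄₃` of that clause remains.
* (RESIDUAL IRREDUCIBILITY, the geometric module) `picard_lambdaTorsion_iso_heart`: for every quartic
  `f ∈ ℤ[X]` separable over `ℚ` and every field `K ⊇ ℚ(ω)` (`IsCyclotomicExtension {3} ℚ K`), the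
  `(1 - ω)`-torsion `J_f[1 - ω] = geomLambdaTorsion K 3 f_K` of the divisor class group of
  `K̄(C_f)`, `C_f : y³ = f(x)` (degree-zero classes fixed by `y ↦ ω y`), is `Γ_K`-equivariantly
  isomorphic to the heart `= (𝔽₃^{roots f})⁰` (`3 ∤ 4`; `augmentationEquivHeart`) — the Schaefer–Zarhin
  module, by the tree's theorem `superelliptic_lambdaTorsion_iso_heart_of_not_dvd`
  (`SuperellipticLambdaTorsionCoprime`, Schaefer 1998 Prop. 3.2 / Zarhin 2018 §8 (i)); and
  `J_f[1 - ω] ⊆ J_f[3]` (`picard_lambdaTorsion_le_jacobianTorsion`).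
* (RESIDUAL IRREDUCIBILITY, assembled over `𝔽₃`) `heartRep_rootSet_map_isIrreducible`: for
  `12 ∣ #Gal(f/ℚ)` that heart — the `𝔽₃[Γ_K]`-module `J_f[1 - ω]` — is irreducible
  (`alternatingGroup_le_range_toPermHom_rootSet_map`, `augmentationRep_rootSet_map_isIrreducible` for the
  root set of `f_K`, and the equivalence `augmentationRepEquivHeartRep`).
* (THE OBJECT) `picardTateGaloisRep`: the `3`-adic Tate module `T₃ J(C_f) = lim← Pic(C_{f,K̄})[3ⁿ]` of
  the Picard curve as a continuous representation of `Γ_K` over `ℤ₃` (`GaloisRep K ℤ_[3] _`), with the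
  deck transformation `y ↦ ω y` commuting with `Γ_K` (`picard_smul_deck_smul_tateModule`) — by the tree's
  `SuperellipticPicGaloisModule` (`Pic(C_{f,K̄})` is a discrete `Γ_K`-module: `picard_continuousSMul_geomPic`).
  Its `ω`-eigenparts are the `ρ` of the fact; their rank, unramifiedness and traces are what is missing.

What is NOT here (no étale cohomology / Tate modules of curves of genus `> 1` over number fields in
Mathlib or in this tree): Néron–Ogg–Shafarevich / good reduction of `K(C_f)`, the Lefschetz trace
formula (zeta function ↔ Frobenius on `T₃`), the rank `#J_f[3ⁿ] = 3^{6n}`, and the comparison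
`T₃/λ ≅ J[λ]`; the object `T₃ J(C_f)` itself IS here (`picardTateGaloisRep`, function-field form).
-/

namespace Literature.NumberTheory.GaloisRepresentations

open scoped NumberField Polynomial Matrix Classical
open Field IsDedekindDomain Polynomial
open Literature.NumberTheory.GaloisRepresentations

/-- **The `λ`-adic Galois representation of a Picard curve** (named fact).  Let `f ∈ ℤ[X]` be a quartic,
separable over `ℚ`; `C_f` the smooth projective model of `y³ = f(x)` over `K = ℚ(ω) = CyclotomicField 3 ℚ`
(a smooth plane quartic `y³z = F(x,z)`, genus `3`, one point `(0:1:0)` at infinity), `J_f` its Jacobian.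
The automorphism `(x, y) ↦ (x, ω y)` is `K`-rational, so `ℤ[ω] ↪ End_K(J_f)` and
`H := H¹_ét(C_{f,K̄}, ℚ₃)` (the `ℚ₃`-dual of the Tate module `V₃ J_f`) is free of rank `3` over
`K ⊗ ℚ₃ = K_λ`, `λ = (1 - ω)`, with a `K_λ`-LINEAR continuous action of `Γ_K`.  For an embedding
`j : K →+* ℚ̄₃` the two eigenspaces of `ω` on `H ⊗_{ℚ₃} ℚ̄₃` (eigenvalues `j(ω)`, `j(ω)²`) are
`Γ_K`-stable of dimension `3`; in a basis, ONE of them is the asserted `ρ : Γ_K → GL₃(ℚ̄₃)`, and: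
* (GOOD REDUCTION) at a finite place `𝔭 ∤ 3` of `K` at which `f mod 𝔭` is still a separable quartic the
  plane model is smooth over `𝓞_{K,𝔭}` (affine singular points need `3y² = f̄'(x) = 0 = f̄(x)`; the point
  at infinity is always smooth), so `J_f` has good reduction and `ρ` is UNRAMIFIED at `𝔭`
  (Serre–Tate, Thm. 1; smooth proper base change);
* (FROBENIUS TRACE) there the GEOMETRIC Frobenius `τ⁻¹` (`τ` an arithmetic Frobenius at `𝔓 ∣ 𝔭`) has
  trace `j(a_𝔭(f))` on `ρ`, `a_𝔭(f) = picardTrace f 𝔭 = -Σ_{x ∈ k_𝔭} χ_𝔭(f̄(x)) ∈ ℤ[ω]`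
  (`CubicResidueSymbol`): by Grothendieck–Lefschetz `#C_f(k_𝔭) = N𝔭 + 1 - tr(τ⁻¹ | H)` while the
  fibre count is `N𝔭 + 1 + S_χ + S_χ̄`, `S_χ = -a_𝔭`; eigenpart by eigenpart this is Weil's
  `L(θ, T) = det(1 - τ⁻¹ T | H[θ])` for the cubic characters `θ` of the Kummer covering `C_f → ℙ¹`, the
  Frobenius of the place `x = x₀` being `y ↦ f̄(x₀)^{(N𝔭-1)/3} y = χ_𝔭(f̄(x₀)) y`; the other eigenspace
  has trace `j(ā_𝔭(f))` — the case `j ∘ conj` of this statement, whence "for every `j`";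
* (RESIDUAL IRREDUCIBILITY) `ρ` has a `Γ_K`-stable lattice (`H¹_ét(C_{f,K̄}, ℤ₃) ⊗_{ℤ₃[ω], j} ℤ̄₃`) with
  reduction the dual of `J_f[1 - ω] ⊗ 𝔽̄₃`, and `J_f[1 - ω] ≅ (𝔽₃^{roots f})⁰` (sum-zero functions on
  the four roots; the case `3 ∤ deg f` — Schaefer 1998, recorded in Zarhin's survey §8 (i)); when
  `12 ∣ #Gal(f/ℚ)`, i.e. `Gal(f/ℚ) ∈ {A₄, S₄}`, the image of `Γ_K` in it contains `A₄`, whose module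
  `(𝔽₃⁴)⁰ = Ind_{V₄}^{A₄}(ψ ≠ 1)` is absolutely irreducible (its restriction to `V₄` is the sum of the
  three non-trivial characters, permuted transitively by `C₃`), hence so are the reduction and `ρ`.
Only these three consequences are asserted (existence form, one `Prop`); the bad places are described by
the MODEL condition, not by `disc f` (for non-monic `f` a prime `p ∣ a₄`, `p ∤ 3 disc f` is of bad,
toric, reduction).  Upton 2009 studies exactly these representations (the `(1 - ζ₃)`-adic
representations of `G_{ℚ(ζ₃)}` attached to Picard curves `y³ = f₄(x)`, their residual representation
on `J[1 - ζ₃]` and their images).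
[cite: Upton2009] [cite: SerreTate1968GoodReduction, Thm. 1]
[cite: DeligneSGA4half1977, Rapport §3 (formule des traces de Lefschetz; fonctions `L`)]
[cite: Zarhin2018SuperellipticJacobians, §8 (i) (arXiv p. 22)] [cite: Schaefer1998] [cite: PoonenSchaefer1997]
[cite: IrelandRosen1982, Ch. 8 §1, Prop. 8.1.5]
[file NumberTheory/GaloisRepresentations/PicardCurveGaloisRep] -/
def picardCurve_exists_lambdaAdicRep : Prop :=
  ∀ (f : ℤ[X]), f.natDegree = 4 → (f.map (Int.castRingHom ℚ)).Separable →
    ∀ (j : CyclotomicField 3 ℚ →+* PadicAlgCl 3),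
      ∃ ρ : FramedGaloisRep (CyclotomicField 3 ℚ) (PadicAlgCl 3) 3,
        (∀ 𝔭 : HeightOneSpectrum (𝓞 (CyclotomicField 3 ℚ)),
            (3 : 𝓞 (CyclotomicField 3 ℚ)) ∉ 𝔭.asIdeal →
            (f.map ((Ideal.Quotient.mk 𝔭.asIdeal).comp
              (algebraMap ℤ (𝓞 (CyclotomicField 3 ℚ))))).natDegree = 4 →
            (f.map ((Ideal.Quotient.mk 𝔭.asIdeal).comp
              (algebraMap ℤ (𝓞 (CyclotomicField 3 ℚ))))).Separable →
              ρ.IsUnramifiedAt 𝔭 ∧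
              ∀ 𝔓 ∈ 𝔭.primesAbove, ∀ τ : absoluteGaloisGroup (CyclotomicField 3 ℚ),
                IsArithFrobAt (𝓞 (CyclotomicField 3 ℚ)) τ 𝔓 →
                  FramedRep.trace ρ τ⁻¹ = j (picardTrace f 𝔭)) ∧
        (12 ∣ Nat.card (f.map (Int.castRingHom ℚ)).Gal → FramedRep.IsAbsolutelyIrreducible ρ)

/-! ## The abstract isomorphism `ℚ̄₃ ≃ ℂ`, and the `j`-form of the stub (wave 1) -/

/-! ## Fibre count of the Picard curve over a residue field (Ireland–Rosen, Ch. 8 §1)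

For `𝔭 ∤ 3` the residue field `k_𝔭 = 𝓞 K ⧸ 𝔭` contains the primitive cube root `ζ mod 𝔭`, so
`3 ∣ N𝔭 - 1` and the number of solutions of `y³ = a` in `k_𝔭` is `1 + χ_𝔭(a) + χ_𝔭(a)²`
(`χ_𝔭 = cubicResidueSymbol 𝔭`, values in `𝓞 K`). Summing over the fibres of `(x, y) ↦ x` gives the
affine point count of `y³ = g(x)`, and for `g = f mod 𝔭` the two character sums are `-picardTrace f 𝔭`
and `-picardTrace (f ^ 2) 𝔭`. -/

section FibreCount

variable {K : Type*} [Field K] [NumberField K] {ζ : 𝓞 K} (hζ : IsPrimitiveRoot ζ 3)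
include hζ

/-- **Cubes are detected by `a^{(N𝔭-1)/3}`.** For `𝔭 ∤ 3` (so that `3 ∣ N𝔭 - 1`,
`three_dvd_residueCard_sub_one`) a nonzero residue `a` with `a^{(N𝔭-1)/3} = 1` is a cube in
`𝓞 K ⧸ 𝔭`: write `a = gⁿ` for a generator `g` of the cyclic group `(𝓞 K ⧸ 𝔭)ˣ` of order
`N𝔭 - 1 = 3m`; then `3m ∣ nm`, so `3 ∣ n` (Ireland–Rosen Prop. 7.1.2, the case `d = 3`; this is the
converse half of `cubicResidueSymbol_spec`). [cite: IrelandRosen1982, Ch. 7 §1, Prop. 7.1.2] -/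
theorem exists_pow_three_eq_of_pow_eq_one {𝔭 : HeightOneSpectrum (𝓞 K)}
    (h3 : (3 : 𝓞 K) ∉ 𝔭.asIdeal) {a : 𝓞 K ⧸ 𝔭.asIdeal} (ha : a ≠ 0)
    (h : a ^ ((𝔭.residueCard - 1) / 3) = 1) :
    ∃ y : 𝓞 K ⧸ 𝔭.asIdeal, y ^ 3 = a := by
  classical
  letI := Ideal.Quotient.field 𝔭.asIdeal
  letI := Fintype.ofFinite (𝓞 K ⧸ 𝔭.asIdeal)
  set m := (𝔭.residueCard - 1) / 3 with hm
  have h3m : 3 * m = 𝔭.residueCard - 1 :=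
    Nat.mul_div_cancel' (three_dvd_residueCard_sub_one hζ h3)
  have hm0 : 0 < m := Nat.pos_of_ne_zero (residueCard_sub_one_div_three_ne_zero hζ h3)
  obtain ⟨g, hg⟩ := IsCyclic.exists_generator (α := (𝓞 K ⧸ 𝔭.asIdeal)ˣ)
  obtain ⟨n, hn⟩ : Units.mk0 a ha ∈ Submonoid.powers g := by
    rw [mem_powers_iff_mem_zpowers]; exact hg _
  have hn : g ^ n = Units.mk0 a ha := hn
  have hord : orderOf g = 3 * m := by
    rw [orderOf_eq_card_of_forall_mem_zpowers hg, Nat.card_units, h3m,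
      HeightOneSpectrum.residueCard_eq_card_quotient]
  have key : 3 * m ∣ n * m := by
    rw [← hord]
    apply orderOf_dvd_of_pow_eq_one
    rw [pow_mul, hn]
    ext
    rw [Units.val_pow_eq_pow_val, Units.val_mk0, h, Units.val_one]
  obtain ⟨t, rfl⟩ := Nat.dvd_of_mul_dvd_mul_right hm0 key
  refine ⟨((g ^ t : (𝓞 K ⧸ 𝔭.asIdeal)ˣ) : 𝓞 K ⧸ 𝔭.asIdeal), ?_⟩
  rw [← Units.val_pow_eq_pow_val, ← pow_mul, mul_comm, hn, Units.val_mk0]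

/-- **`N(y³ = a) = 1 + χ(a) + χ(a)²`** (Ireland–Rosen Prop. 8.1.5 for `n = 3`: the number of
solutions of `y³ = a` is the sum of `ψ(a)` over the characters `ψ ∈ {ε, χ_𝔭, χ_𝔭²}` of order dividing
`3`, with `ε(0) = 1`), for `𝔭 ∤ 3`, counted as the number of distinct roots of `Y³ - a` and read in
`𝓞 K`: for `a = 0` both sides are `1`; for a nonzero cube `a = α³` there are `3` cube roots
(`IsPrimitiveRoot.card_nthRoots`, `ζ mod 𝔭` being a primitive cube root of unity) and `χ_𝔭(a) = 1`;
for a non-cube there are none and `χ_𝔭(a) ∈ {ζ, ζ²}` (by `exists_pow_three_eq_of_pow_eq_one`), so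
`1 + χ + χ² = (χ³ - 1)/(χ - 1) = 0`. [cite: IrelandRosen1982, Ch. 8 §1, Prop. 8.1.5] -/
theorem toFinset_card_nthRoots_three {𝔭 : HeightOneSpectrum (𝓞 K)}
    (h3 : (3 : 𝓞 K) ∉ 𝔭.asIdeal) [DecidableEq (𝓞 K ⧸ 𝔭.asIdeal)] (a : 𝓞 K ⧸ 𝔭.asIdeal) :
    ((nthRoots 3 a).toFinset.card : 𝓞 K) =
      1 + cubicResidueSymbol 𝔭 a + cubicResidueSymbol 𝔭 a ^ 2 := by
  letI := Ideal.Quotient.field 𝔭.asIdeal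
  letI := Fintype.ofFinite (𝓞 K ⧸ 𝔭.asIdeal)
  have hζ' : IsPrimitiveRoot (Ideal.Quotient.mk 𝔭.asIdeal ζ) 3 :=
    isPrimitiveRoot_mk_of_three_not_mem hζ h3
  rcases eq_or_ne a 0 with rfl | ha
  · rw [cubicResidueSymbol_zero hζ, nthRoots_zero_right]
    have : (Multiset.replicate 3 (0 : 𝓞 K ⧸ 𝔭.asIdeal)).toFinset = {0} := by
      ext x; simp
    rw [this]
    simp
  · rw [Multiset.toFinset_card_of_nodup (hζ'.nthRoots_nodup ha), hζ'.card_nthRoots]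
    obtain ⟨hχ3, hχ⟩ := cubicResidueSymbol_spec hζ h3 ha
    split_ifs with hcube
    · obtain ⟨α, rfl⟩ := hcube
      have hα : α ≠ 0 := by
        rintro rfl
        exact ha (zero_pow three_ne_zero)
      have h1 : cubicResidueSymbol 𝔭 (α ^ 3) = 1 := by
        refine cubicResidueSymbol_eq_of_pow_three_eq_one hζ h3 (one_pow 3) ?_
        rw [map_one, ← pow_mul, mul_comm, pow_mul]
        exact (pow_residueCard_sub_one_div_three_pow_three hζ h3 hα).symm
      rw [h1]
      norm_num
    · have hne : cubicResidueSymbol 𝔭 a ≠ 1 := by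
        intro h1
        apply hcube
        exact exists_pow_three_eq_of_pow_eq_one hζ h3 ha (by rw [← hχ, h1, map_one])
      have hfac : (cubicResidueSymbol 𝔭 a - 1) *
          (1 + cubicResidueSymbol 𝔭 a + cubicResidueSymbol 𝔭 a ^ 2) = 0 := by
        linear_combination hχ3
      rcases mul_eq_zero.1 hfac with h0 | h0
      · exact absurd (sub_eq_zero.1 h0) hne
      · rw [h0, Nat.cast_zero]

/-- `#{y ∈ 𝓞 K ⧸ 𝔭 : y³ = a} = 1 + χ_𝔭(a) + χ_𝔭(a)²` in `𝓞 K`, for `𝔭 ∤ 3` — Ireland–Rosen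
Prop. 8.1.5 (`n = 3`) as a `Fintype.card` of the solution set.
[cite: IrelandRosen1982, Ch. 8 §1, Prop. 8.1.5] -/
theorem card_subtype_pow_three_eq {𝔭 : HeightOneSpectrum (𝓞 K)}
    (h3 : (3 : 𝓞 K) ∉ 𝔭.asIdeal) [Fintype (𝓞 K ⧸ 𝔭.asIdeal)] [DecidableEq (𝓞 K ⧸ 𝔭.asIdeal)]
    (a : 𝓞 K ⧸ 𝔭.asIdeal) :
    (Fintype.card {y : 𝓞 K ⧸ 𝔭.asIdeal // y ^ 3 = a} : 𝓞 K) =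
      1 + cubicResidueSymbol 𝔭 a + cubicResidueSymbol 𝔭 a ^ 2 := by
  rw [← toFinset_card_nthRoots_three hζ h3 a, Fintype.card_subtype]
  congr 2
  ext y
  simp [mem_nthRoots]

/-- **Affine point count of a cyclic cubic cover** `y³ = g(x)` over the residue field at `𝔭 ∤ 3`:
`#{(x, y) : y³ = g(x)} = N𝔭 + Σ_x χ_𝔭(g(x)) + Σ_x χ_𝔭(g(x))²` in `𝓞 K` (sum the fibre count
`card_subtype_pow_three_eq` over `x`; Ireland–Rosen Ch. 8 §§1, 3, the computation behind
`N(y³ = f(x))` via Jacobi sums). [cite: IrelandRosen1982, Ch. 8 §1, Prop. 8.1.5] -/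
theorem card_affinePoints_cubicCover {𝔭 : HeightOneSpectrum (𝓞 K)}
    (h3 : (3 : 𝓞 K) ∉ 𝔭.asIdeal) [Fintype (𝓞 K ⧸ 𝔭.asIdeal)] [DecidableEq (𝓞 K ⧸ 𝔭.asIdeal)]
    (g : (𝓞 K ⧸ 𝔭.asIdeal)[X]) :
    (Fintype.card {p : (𝓞 K ⧸ 𝔭.asIdeal) × (𝓞 K ⧸ 𝔭.asIdeal) // p.2 ^ 3 = g.eval p.1} : 𝓞 K) =
      Fintype.card (𝓞 K ⧸ 𝔭.asIdeal) + ∑ x, cubicResidueSymbol 𝔭 (g.eval x) +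
        ∑ x, cubicResidueSymbol 𝔭 (g.eval x) ^ 2 := by
  have e : {p : (𝓞 K ⧸ 𝔭.asIdeal) × (𝓞 K ⧸ 𝔭.asIdeal) // p.2 ^ 3 = g.eval p.1} ≃
      Σ x : 𝓞 K ⧸ 𝔭.asIdeal, {y : 𝓞 K ⧸ 𝔭.asIdeal // y ^ 3 = g.eval x} :=
    { toFun := fun p => ⟨p.1.1, p.1.2, p.2⟩
      invFun := fun q => ⟨(q.1, q.2.1), q.2.2⟩
      left_inv := fun p => rfl
      right_inv := fun q => rfl }
  rw [Fintype.card_congr e, Fintype.card_sigma, Nat.cast_sum]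
  simp_rw [card_subtype_pow_three_eq hζ h3]
  rw [Finset.sum_add_distrib, Finset.sum_add_distrib, Finset.sum_const, Finset.card_univ,
    nsmul_eq_mul, mul_one]

end FibreCount

/-- **Affine point count of the Picard curve modulo `𝔭 ∤ 3`**: for `f ∈ ℤ[X]`, a number field
`K` whose integers contain a primitive cube root of unity, and a finite place `𝔭 ∤ 3` of `K`,
`#{(x, y) ∈ (𝓞 K ⧸ 𝔭)² : y³ = f̄(x)} = N𝔭 - a_𝔭(f) - a_𝔭(f²)` in `𝓞 K`, where
`a_𝔭 = picardTrace` (`= -Σ_x χ_𝔭(f̄ x)`) and `a_𝔭(f²) = -Σ_x χ_𝔭(f̄ x)²` is the conjugate sum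
`-S_χ̄` (under any `σ : 𝓞 K →+* ℂ`, `σ(a_𝔭(f²)) = conj σ(a_𝔭(f))`,
`starRingEnd_map_cubicResidueSymbol_eq_map_sq`). For `deg f̄ = 4` the smooth plane model has exactly
one more point, at infinity, so `#C_f(k_𝔭) = N𝔭 + 1 + S_χ + S_χ̄` — the fibre-count half of the
FROBENIUS TRACE clause of `picardCurve_exists_lambdaAdicRep` (the other half being the Lefschetz trace
formula, not available). [cite: IrelandRosen1982, Ch. 8 §1, Prop. 8.1.5] -/
theorem picard_card_affinePoints {K : Type*} [Field K] [NumberField K] {ζ : 𝓞 K}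
    (hζ : IsPrimitiveRoot ζ 3) (f : ℤ[X]) {𝔭 : HeightOneSpectrum (𝓞 K)}
    (h3 : (3 : 𝓞 K) ∉ 𝔭.asIdeal) [Fintype (𝓞 K ⧸ 𝔭.asIdeal)] [DecidableEq (𝓞 K ⧸ 𝔭.asIdeal)] :
    (Fintype.card {p : (𝓞 K ⧸ 𝔭.asIdeal) × (𝓞 K ⧸ 𝔭.asIdeal) //
        p.2 ^ 3 = (f.map ((Ideal.Quotient.mk 𝔭.asIdeal).comp (algebraMap ℤ (𝓞 K)))).eval p.1}
        : 𝓞 K) =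
      𝔭.residueCard - picardTrace f 𝔭 - picardTrace (f ^ 2) 𝔭 := by
  rw [card_affinePoints_cubicCover hζ h3, picardTrace_eq_neg_sum, picardTrace_eq_neg_sum,
    HeightOneSpectrum.residueCard_eq_card_quotient, Nat.card_eq_fintype_card]
  simp only [Polynomial.map_pow, eval_pow, cubicResidueSymbol_sq hζ, sub_neg_eq_add]

/-- The special case `K = ℚ(ω) = CyclotomicField 3 ℚ` of `picard_card_affinePoints` (the field of
`picardCurve_exists_lambdaAdicRep`), with the cube root of unity supplied by
`exists_isPrimitiveRoot_three_cyclotomicField`. [cite: IrelandRosen1982, Ch. 8 §1, Prop. 8.1.5] -/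
theorem picard_card_affinePoints_cyclotomicField (f : ℤ[X])
    {𝔭 : HeightOneSpectrum (𝓞 (CyclotomicField 3 ℚ))}
    (h3 : (3 : 𝓞 (CyclotomicField 3 ℚ)) ∉ 𝔭.asIdeal)
    [Fintype (𝓞 (CyclotomicField 3 ℚ) ⧸ 𝔭.asIdeal)]
    [DecidableEq (𝓞 (CyclotomicField 3 ℚ) ⧸ 𝔭.asIdeal)] :
    (Fintype.card {p : (𝓞 (CyclotomicField 3 ℚ) ⧸ 𝔭.asIdeal) ×
        (𝓞 (CyclotomicField 3 ℚ) ⧸ 𝔭.asIdeal) //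
        p.2 ^ 3 = (f.map ((Ideal.Quotient.mk 𝔭.asIdeal).comp
          (algebraMap ℤ (𝓞 (CyclotomicField 3 ℚ))))).eval p.1} : 𝓞 (CyclotomicField 3 ℚ)) =
      𝔭.residueCard - picardTrace f 𝔭 - picardTrace (f ^ 2) 𝔭 := by
  obtain ⟨ζ, hζ⟩ := exists_isPrimitiveRoot_three_cyclotomicField
  exact picard_card_affinePoints hζ f h3

/-! ## The sum-zero module of four points is irreducible for `A₄` in characteristic `≠ 2`

The RESIDUAL IRREDUCIBILITY clause rests on: for a field `F` with `2 ≠ 0` and a `G`-set `X` of four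
points on which `G` induces at least the alternating group, the augmentation representation
`(F^X)⁰ = ker(Σ)` (`augmentationRep`, file `SteinbergArtinRep`) is irreducible; applied to every
`F ⊇ 𝔽₃` this is the absolute irreducibility of `(𝔽₃^{roots f})⁰`, the Schaefer–Zarhin model of
`J_f[1 - ω]`, when the Galois image contains `A₄`.  Proof (Klein four eigenlines): with
`V₄ = {1, g₁, g₂, g₁g₂}` acting simply transitively on `X = {a, b, c, d}`, the three Klein
projectors `1 + g₁ - g₂ - g₁g₂`, `1 - g₁ + g₂ - g₁g₂`, `1 - g₁ - g₂ + g₁g₂` (the non-trivial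
characters of `V₄`) map `w` to `λᵢ(w) uᵢ` for the sign vectors
`u₁ = e_a + e_b - e_c - e_d`, `u₂ = e_a - e_b + e_c - e_d`, `u₃ = e_a - e_b - e_c + e_d`, and
`4w = Σ λᵢ(w) uᵢ` on the sum-zero hyperplane; so a nonzero stable subspace contains some `uᵢ`, the
`3`-cycle `(b c d)` rotates `u₁ ↦ u₂ ↦ u₃ ↦ u₁`, and the `uᵢ` span the hyperplane (`4 ≠ 0`).
(Cf. Zarhin 2018, Lemma 7.4 (i) after Klemm, and Mortimer 1980, for hearts of permutation modules of
doubly transitive groups in general.) -/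

section HeartA4

variable {k : Type*} [Field k] {G : Type*} [Group G] {X : Type*} [MulAction G X]

/-- The permutation representation in coordinates: `(g · w)(x) = w(g⁻¹ x)`. [folklore] -/
theorem permRep_apply_apply (g : G) (w : X →₀ k) (x : X) :
    permRep k G X g w x = w (g⁻¹ • x) := by
  simp only [permRep, MonoidHom.coe_mk, OneHom.coe_mk, Finsupp.lmapDomain_apply]
  conv_lhs => rw [← smul_inv_smul g x]
  exact Finsupp.mapDomain_apply (MulAction.injective g) w (g⁻¹ • x)

omit [Field k] in
/-- `g x = y → g⁻¹ y = x` (inverse action table). [folklore] -/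
theorem inv_smul_eq_of_smul_eq_perm {g : G} {x y : X} (h : g • x = y) : g⁻¹ • y = x := by
  rw [inv_smul_eq_iff, h]

variable [DecidableEq X]

/-- Klein projector identity, character `(+, -)`: `w + g₁w - g₂w - g₁g₂w = λ₁(w) u₁` with
`λ₁(w) = w_a + w_b - w_c - w_d`, `u₁ = e_a + e_b - e_c - e_d`, for `g₁ = (a b)(c d)`,
`g₂ = (a c)(b d)` on `X = {a, b, c, d}`. [folklore] -/
theorem klein_proj_one {a b c d : X} (hd : a ≠ b ∧ a ≠ c ∧ a ≠ d ∧ b ≠ c ∧ b ≠ d ∧ c ≠ d)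
    (hcov : ∀ x : X, x = a ∨ x = b ∨ x = c ∨ x = d) {g₁ g₂ : G}
    (h₁ : g₁ • a = b ∧ g₁ • b = a ∧ g₁ • c = d ∧ g₁ • d = c)
    (h₂ : g₂ • a = c ∧ g₂ • b = d ∧ g₂ • c = a ∧ g₂ • d = b) (w : X →₀ k) :
    w + permRep k G X g₁ w - permRep k G X g₂ w - permRep k G X (g₁ * g₂) w =
      (w a + w b - w c - w d) •
        (Finsupp.single a (1 : k) + Finsupp.single b 1 + Finsupp.single c (-1) +
          Finsupp.single d (-1)) := by
  obtain ⟨hab, hac, had, hbc, hbd, hcd⟩ := hd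
  obtain ⟨ha₁, hb₁, hc₁, hd₁⟩ := h₁
  obtain ⟨ha₂, hb₂, hc₂, hd₂⟩ := h₂
  have ia₁ := inv_smul_eq_of_smul_eq_perm hb₁; have ib₁ := inv_smul_eq_of_smul_eq_perm ha₁
  have ic₁ := inv_smul_eq_of_smul_eq_perm hd₁; have id₁ := inv_smul_eq_of_smul_eq_perm hc₁
  have ia₂ := inv_smul_eq_of_smul_eq_perm hc₂; have ib₂ := inv_smul_eq_of_smul_eq_perm hd₂
  have ic₂ := inv_smul_eq_of_smul_eq_perm ha₂; have id₂ := inv_smul_eq_of_smul_eq_perm hb₂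
  ext x
  simp only [Finsupp.coe_add, Finsupp.coe_sub, Pi.add_apply, Pi.sub_apply, permRep_apply_apply,
    mul_inv_rev, mul_smul, Finsupp.coe_smul, Pi.smul_apply, smul_eq_mul, Finsupp.single_apply]
  rcases hcov x with rfl | rfl | rfl | rfl
  · simp only [ia₁, ia₂, ib₂, if_true, if_neg hab.symm, if_neg hac.symm, if_neg had.symm]; ring
  · simp only [ib₁, ib₂, ia₂, if_true, if_neg hab, if_neg hbc.symm, if_neg hbd.symm]; ring
  · simp only [ic₁, ic₂, id₂, if_true, if_neg hac, if_neg hbc, if_neg hcd.symm]; ring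
  · simp only [id₁, id₂, ic₂, if_true, if_neg had, if_neg hbd, if_neg hcd]; ring

/-- Klein projector identity, character `(-, +)`: `w - g₁w + g₂w - g₁g₂w = λ₂(w) u₂`,
`λ₂(w) = w_a - w_b + w_c - w_d`, `u₂ = e_a - e_b + e_c - e_d`. [folklore] -/
theorem klein_proj_two {a b c d : X} (hd : a ≠ b ∧ a ≠ c ∧ a ≠ d ∧ b ≠ c ∧ b ≠ d ∧ c ≠ d)
    (hcov : ∀ x : X, x = a ∨ x = b ∨ x = c ∨ x = d) {g₁ g₂ : G}
    (h₁ : g₁ • a = b ∧ g₁ • b = a ∧ g₁ • c = d ∧ g₁ • d = c)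
    (h₂ : g₂ • a = c ∧ g₂ • b = d ∧ g₂ • c = a ∧ g₂ • d = b) (w : X →₀ k) :
    w - permRep k G X g₁ w + permRep k G X g₂ w - permRep k G X (g₁ * g₂) w =
      (w a - w b + w c - w d) •
        (Finsupp.single a (1 : k) + Finsupp.single b (-1) + Finsupp.single c 1 +
          Finsupp.single d (-1)) := by
  obtain ⟨hab, hac, had, hbc, hbd, hcd⟩ := hd
  obtain ⟨ha₁, hb₁, hc₁, hd₁⟩ := h₁
  obtain ⟨ha₂, hb₂, hc₂, hd₂⟩ := h₂
  have ia₁ := inv_smul_eq_of_smul_eq_perm hb₁; have ib₁ := inv_smul_eq_of_smul_eq_perm ha₁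
  have ic₁ := inv_smul_eq_of_smul_eq_perm hd₁; have id₁ := inv_smul_eq_of_smul_eq_perm hc₁
  have ia₂ := inv_smul_eq_of_smul_eq_perm hc₂; have ib₂ := inv_smul_eq_of_smul_eq_perm hd₂
  have ic₂ := inv_smul_eq_of_smul_eq_perm ha₂; have id₂ := inv_smul_eq_of_smul_eq_perm hb₂
  ext x
  simp only [Finsupp.coe_add, Finsupp.coe_sub, Pi.add_apply, Pi.sub_apply, permRep_apply_apply,
    mul_inv_rev, mul_smul, Finsupp.coe_smul, Pi.smul_apply, smul_eq_mul, Finsupp.single_apply]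
  rcases hcov x with rfl | rfl | rfl | rfl
  · simp only [ia₁, ia₂, ib₂, if_true, if_neg hab.symm, if_neg hac.symm, if_neg had.symm]; ring
  · simp only [ib₁, ib₂, ia₂, if_true, if_neg hab, if_neg hbc.symm, if_neg hbd.symm]; ring
  · simp only [ic₁, ic₂, id₂, if_true, if_neg hac, if_neg hbc, if_neg hcd.symm]; ring
  · simp only [id₁, id₂, ic₂, if_true, if_neg had, if_neg hbd, if_neg hcd]; ring

/-- Klein projector identity, character `(-, -)`: `w - g₁w - g₂w + g₁g₂w = λ₃(w) u₃`,
`λ₃(w) = w_a - w_b - w_c + w_d`, `u₃ = e_a - e_b - e_c + e_d`. [folklore] -/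
theorem klein_proj_three {a b c d : X} (hd : a ≠ b ∧ a ≠ c ∧ a ≠ d ∧ b ≠ c ∧ b ≠ d ∧ c ≠ d)
    (hcov : ∀ x : X, x = a ∨ x = b ∨ x = c ∨ x = d) {g₁ g₂ : G}
    (h₁ : g₁ • a = b ∧ g₁ • b = a ∧ g₁ • c = d ∧ g₁ • d = c)
    (h₂ : g₂ • a = c ∧ g₂ • b = d ∧ g₂ • c = a ∧ g₂ • d = b) (w : X →₀ k) :
    w - permRep k G X g₁ w - permRep k G X g₂ w + permRep k G X (g₁ * g₂) w =
      (w a - w b - w c + w d) •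
        (Finsupp.single a (1 : k) + Finsupp.single b (-1) + Finsupp.single c (-1) +
          Finsupp.single d 1) := by
  obtain ⟨hab, hac, had, hbc, hbd, hcd⟩ := hd
  obtain ⟨ha₁, hb₁, hc₁, hd₁⟩ := h₁
  obtain ⟨ha₂, hb₂, hc₂, hd₂⟩ := h₂
  have ia₁ := inv_smul_eq_of_smul_eq_perm hb₁; have ib₁ := inv_smul_eq_of_smul_eq_perm ha₁
  have ic₁ := inv_smul_eq_of_smul_eq_perm hd₁; have id₁ := inv_smul_eq_of_smul_eq_perm hc₁
  have ia₂ := inv_smul_eq_of_smul_eq_perm hc₂; have ib₂ := inv_smul_eq_of_smul_eq_perm hd₂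
  have ic₂ := inv_smul_eq_of_smul_eq_perm ha₂; have id₂ := inv_smul_eq_of_smul_eq_perm hb₂
  ext x
  simp only [Finsupp.coe_add, Finsupp.coe_sub, Pi.add_apply, Pi.sub_apply, permRep_apply_apply,
    mul_inv_rev, mul_smul, Finsupp.coe_smul, Pi.smul_apply, smul_eq_mul, Finsupp.single_apply]
  rcases hcov x with rfl | rfl | rfl | rfl
  · simp only [ia₁, ia₂, ib₂, if_true, if_neg hab.symm, if_neg hac.symm, if_neg had.symm]; ring
  · simp only [ib₁, ib₂, ia₂, if_true, if_neg hab, if_neg hbc.symm, if_neg hbd.symm]; ring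
  · simp only [ic₁, ic₂, id₂, if_true, if_neg hac, if_neg hbc, if_neg hcd.symm]; ring
  · simp only [id₁, id₂, ic₂, if_true, if_neg had, if_neg hbd, if_neg hcd]; ring

omit [Group G] [MulAction G X] in
/-- On the sum-zero hyperplane `4w = λ₁(w) u₁ + λ₂(w) u₂ + λ₃(w) u₃` (the four Klein projectors sum
to `4`, and the trivial one vanishes on `ker Σ`). [folklore] -/
theorem klein_decomposition {a b c d : X} (hd : a ≠ b ∧ a ≠ c ∧ a ≠ d ∧ b ≠ c ∧ b ≠ d ∧ c ≠ d)
    (hcov : ∀ x : X, x = a ∨ x = b ∨ x = c ∨ x = d) {w : X →₀ k}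
    (hw : w a + w b + w c + w d = 0) :
    (4 : k) • w =
      (w a + w b - w c - w d) •
          (Finsupp.single a (1 : k) + Finsupp.single b 1 + Finsupp.single c (-1) +
            Finsupp.single d (-1)) +
        (w a - w b + w c - w d) •
          (Finsupp.single a (1 : k) + Finsupp.single b (-1) + Finsupp.single c 1 +
            Finsupp.single d (-1)) +
        (w a - w b - w c + w d) •
          (Finsupp.single a (1 : k) + Finsupp.single b (-1) + Finsupp.single c (-1) +
            Finsupp.single d 1) := by
  obtain ⟨hab, hac, had, hbc, hbd, hcd⟩ := hd
  ext x
  simp only [Finsupp.coe_add, Pi.add_apply, Finsupp.coe_smul, Pi.smul_apply, smul_eq_mul,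
    Finsupp.single_apply]
  rcases hcov x with rfl | rfl | rfl | rfl
  · simp only [if_true, if_neg hab.symm, if_neg hac.symm, if_neg had.symm]; linear_combination hw
  · simp only [if_true, if_neg hab, if_neg hbc.symm, if_neg hbd.symm]; linear_combination hw
  · simp only [if_true, if_neg hac, if_neg hbc, if_neg hcd.symm]; linear_combination hw
  · simp only [if_true, if_neg had, if_neg hbd, if_neg hcd]; linear_combination hw

omit [DecidableEq X] in
/-- The `3`-cycle `(b c d)` rotates the sign vectors:
`g₃ · (e_a + s e_b + t e_c + r e_d) = e_a + r e_b + s e_c + t e_d`. [folklore] -/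
theorem permRep_threeCycle_signVector {a b c d : X} {g₃ : G}
    (h₃ : g₃ • a = a ∧ g₃ • b = c ∧ g₃ • c = d ∧ g₃ • d = b) (s t r : k) :
    permRep k G X g₃ (Finsupp.single a (1 : k) + Finsupp.single b s + Finsupp.single c t +
        Finsupp.single d r) =
      Finsupp.single a (1 : k) + Finsupp.single b r + Finsupp.single c s + Finsupp.single d t := by
  obtain ⟨ha₃, hb₃, hc₃, hd₃⟩ := h₃
  simp only [map_add, permRep_single, ha₃, hb₃, hc₃, hd₃]
  abel

omit [Group G] [MulAction G X] in
/-- A finitely supported function on `X = {a, b, c, d}` in coordinates. [folklore] -/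
theorem finsupp_eq_sum_single_four {a b c d : X}
    (hd : a ≠ b ∧ a ≠ c ∧ a ≠ d ∧ b ≠ c ∧ b ≠ d ∧ c ≠ d)
    (hcov : ∀ x : X, x = a ∨ x = b ∨ x = c ∨ x = d) (w : X →₀ k) :
    w = Finsupp.single a (w a) + Finsupp.single b (w b) + Finsupp.single c (w c) +
      Finsupp.single d (w d) := by
  obtain ⟨hab, hac, had, hbc, hbd, hcd⟩ := hd
  ext x
  simp only [Finsupp.coe_add, Pi.add_apply, Finsupp.single_apply]
  rcases hcov x with rfl | rfl | rfl | rfl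
  · simp only [if_true, if_neg hab.symm, if_neg hac.symm, if_neg had.symm]; ring
  · simp only [if_true, if_neg hab, if_neg hbc.symm, if_neg hbd.symm]; ring
  · simp only [if_true, if_neg hac, if_neg hbc, if_neg hcd.symm]; ring
  · simp only [if_true, if_neg had, if_neg hbd, if_neg hcd]; ring

omit [Group G] [MulAction G X] in
/-- The augmentation `Σ` on `X = {a, b, c, d}` in coordinates. [folklore] -/
theorem augmentation_eq_four {a b c d : X}
    (hd : a ≠ b ∧ a ≠ c ∧ a ≠ d ∧ b ≠ c ∧ b ≠ d ∧ c ≠ d)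
    (hcov : ∀ x : X, x = a ∨ x = b ∨ x = c ∨ x = d) (w : X →₀ k) :
    augmentation k X w = w a + w b + w c + w d := by
  conv_lhs => rw [finsupp_eq_sum_single_four hd hcov w]
  simp only [map_add, augmentation_single]

/-- **Core lemma.** For a field with `2 ≠ 0` and a `G`-set `X = {a, b, c, d}` carrying elements
`g₁, g₂, g₃ ∈ G` acting as `(a b)(c d)`, `(a c)(b d)`, `(b c d)` (an `A₄`-configuration), every
nonzero `G`-stable subspace of the augmentation hyperplane `(k^X)⁰` is the whole hyperplane.
[folklore] -/
theorem eq_augmentationSubmodule_of_kleinStable (h2 : (2 : k) ≠ 0) {a b c d : X}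
    (hd : a ≠ b ∧ a ≠ c ∧ a ≠ d ∧ b ≠ c ∧ b ≠ d ∧ c ≠ d)
    (hcov : ∀ x : X, x = a ∨ x = b ∨ x = c ∨ x = d) {g₁ g₂ g₃ : G}
    (h₁ : g₁ • a = b ∧ g₁ • b = a ∧ g₁ • c = d ∧ g₁ • d = c)
    (h₂ : g₂ • a = c ∧ g₂ • b = d ∧ g₂ • c = a ∧ g₂ • d = b)
    (h₃ : g₃ • a = a ∧ g₃ • b = c ∧ g₃ • c = d ∧ g₃ • d = b)
    {W : Submodule k (X →₀ k)} (hW : W ≤ augmentationSubmodule k X)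
    (hst : ∀ g : G, ∀ w ∈ W, permRep k G X g w ∈ W) (hne : W ≠ ⊥) :
    W = augmentationSubmodule k X := by
  have h4 : (4 : k) ≠ 0 := by
    have : (4 : k) = 2 * 2 := by norm_num
    rw [this]; exact mul_ne_zero h2 h2
  -- the sign vectors
  set u₁ : X →₀ k := Finsupp.single a (1 : k) + Finsupp.single b 1 + Finsupp.single c (-1) +
    Finsupp.single d (-1) with hu₁
  set u₂ : X →₀ k := Finsupp.single a (1 : k) + Finsupp.single b (-1) + Finsupp.single c 1 +
    Finsupp.single d (-1) with hu₂
  set u₃ : X →₀ k := Finsupp.single a (1 : k) + Finsupp.single b (-1) + Finsupp.single c (-1) +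
    Finsupp.single d 1 with hu₃
  -- rotation by the 3-cycle
  have r₁ : permRep k G X g₃ u₁ = u₂ := permRep_threeCycle_signVector h₃ 1 (-1) (-1)
  have r₂ : permRep k G X g₃ u₂ = u₃ := permRep_threeCycle_signVector h₃ (-1) 1 (-1)
  have r₃ : permRep k G X g₃ u₃ = u₁ := permRep_threeCycle_signVector h₃ (-1) (-1) 1
  -- Step 1: some `uᵢ` lies in `W`
  obtain ⟨w, hwW, hw0⟩ := (Submodule.ne_bot_iff W).1 hne
  have hsum : w a + w b + w c + w d = 0 := by
    rw [← augmentation_eq_four hd hcov w]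
    exact (mem_augmentationSubmodule_iff k w).1 (hW hwW)
  have p₁ : (w a + w b - w c - w d) • u₁ ∈ W := by
    rw [← klein_proj_one hd hcov h₁ h₂ w]
    exact W.sub_mem (W.sub_mem (W.add_mem hwW (hst g₁ w hwW)) (hst g₂ w hwW))
      (hst (g₁ * g₂) w hwW)
  have p₂ : (w a - w b + w c - w d) • u₂ ∈ W := by
    rw [← klein_proj_two hd hcov h₁ h₂ w]
    exact W.sub_mem (W.add_mem (W.sub_mem hwW (hst g₁ w hwW)) (hst g₂ w hwW))
      (hst (g₁ * g₂) w hwW)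
  have p₃ : (w a - w b - w c + w d) • u₃ ∈ W := by
    rw [← klein_proj_three hd hcov h₁ h₂ w]
    exact W.add_mem (W.sub_mem (W.sub_mem hwW (hst g₁ w hwW)) (hst g₂ w hwW))
      (hst (g₁ * g₂) w hwW)
  have hall : u₁ ∈ W ∧ u₂ ∈ W ∧ u₃ ∈ W := by
    by_cases c₁ : w a + w b - w c - w d = 0
    · by_cases c₂ : w a - w b + w c - w d = 0
      · by_cases c₃ : w a - w b - w c + w d = 0
        · exfalso
          apply hw0
          have h4w : (4 : k) • w = 0 := by
            rw [klein_decomposition hd hcov hsum, c₁, c₂, c₃, zero_smul, zero_smul, zero_smul,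
              add_zero, add_zero]
          exact (smul_eq_zero.1 h4w).resolve_left h4
        · have m₃ : u₃ ∈ W := by simpa [c₃] using W.smul_mem (w a - w b - w c + w d)⁻¹ p₃
          have m₁ : u₁ ∈ W := r₃ ▸ hst g₃ u₃ m₃
          exact ⟨m₁, r₁ ▸ hst g₃ u₁ m₁, m₃⟩
      · have m₂ : u₂ ∈ W := by simpa [c₂] using W.smul_mem (w a - w b + w c - w d)⁻¹ p₂
        have m₃ : u₃ ∈ W := r₂ ▸ hst g₃ u₂ m₂
        exact ⟨r₃ ▸ hst g₃ u₃ m₃, m₂, m₃⟩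
    · have m₁ : u₁ ∈ W := by simpa [c₁] using W.smul_mem (w a + w b - w c - w d)⁻¹ p₁
      have m₂ : u₂ ∈ W := r₁ ▸ hst g₃ u₁ m₁
      exact ⟨m₁, m₂, r₂ ▸ hst g₃ u₂ m₂⟩
  obtain ⟨m₁, m₂, m₃⟩ := hall
  -- Step 2: the `uᵢ` span the augmentation hyperplane
  refine le_antisymm hW fun v hv => ?_
  have hv' : v a + v b + v c + v d = 0 := by
    rw [← augmentation_eq_four hd hcov v]
    exact (mem_augmentationSubmodule_iff k v).1 hv
  have h4v : (4 : k) • v ∈ W := by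
    rw [klein_decomposition hd hcov hv']
    exact W.add_mem (W.add_mem (W.smul_mem _ m₁) (W.smul_mem _ m₂)) (W.smul_mem _ m₃)
  simpa [h4] using W.smul_mem (4 : k)⁻¹ h4v

/-- **Irreducibility of the augmentation representation of an `A₄`-configuration**: with
`k, X, g₁, g₂, g₃` as in `eq_augmentationSubmodule_of_kleinStable`, the representation
`augmentationRep k G X` of `G` on `(k^X)⁰` is irreducible (Mathlib `Representation.IsIrreducible`:
the lattice of subrepresentations is `{⊥, ⊤}`, and `⊥ ≠ ⊤` as `e_a - e_b ≠ 0`). [folklore] -/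
theorem augmentationRep_isIrreducible_of_kleinConfig (h2 : (2 : k) ≠ 0) {a b c d : X}
    (hd : a ≠ b ∧ a ≠ c ∧ a ≠ d ∧ b ≠ c ∧ b ≠ d ∧ c ≠ d)
    (hcov : ∀ x : X, x = a ∨ x = b ∨ x = c ∨ x = d) {g₁ g₂ g₃ : G}
    (h₁ : g₁ • a = b ∧ g₁ • b = a ∧ g₁ • c = d ∧ g₁ • d = c)
    (h₂ : g₂ • a = c ∧ g₂ • b = d ∧ g₂ • c = a ∧ g₂ • d = b)
    (h₃ : g₃ • a = a ∧ g₃ • b = c ∧ g₃ • c = d ∧ g₃ • d = b) :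
    Representation.IsIrreducible (k := k) (G := G) (V := augmentationSubmodule k X)
      (augmentationRep k G X) := by
  -- a nonzero vector `e_a - e_b` of the augmentation hyperplane
  have hmem : Finsupp.single a (1 : k) - Finsupp.single b 1 ∈ augmentationSubmodule k X := by
    rw [mem_augmentationSubmodule_iff, map_sub, augmentation_single, augmentation_single, sub_self]
  have hne0 : (⟨_, hmem⟩ : augmentationSubmodule k X) ≠ 0 := by
    intro h
    have h' := congrArg (fun v : augmentationSubmodule k X => (v : X →₀ k) a) h
    simp only [Finsupp.coe_sub, Pi.sub_apply, Finsupp.single_eq_same, Finsupp.single_apply,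
      if_neg (Ne.symm hd.1), sub_zero, Submodule.coe_zero, Finsupp.coe_zero, Pi.zero_apply] at h'
    exact one_ne_zero h'
  have hbt : (⊥ : Subrepresentation (augmentationRep k G X)) ≠ ⊤ := by
    intro h
    have ht : (⟨_, hmem⟩ : augmentationSubmodule k X) ∈
        (⊤ : Subrepresentation (augmentationRep k G X)).toSubmodule := Submodule.mem_top
    rw [← h] at ht
    exact hne0 ((Submodule.mem_bot k).1 ht)
  haveI : Nontrivial (Subrepresentation (augmentationRep k G X)) := ⟨⟨⊥, ⊤, hbt⟩⟩
  refine ⟨fun S => ?_⟩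
  -- push `S` forward to a Klein-stable subspace of `k^X`
  set W : Submodule k (X →₀ k) := S.toSubmodule.map (augmentationSubmodule k X).subtype with hWdef
  have hW : W ≤ augmentationSubmodule k X := Submodule.map_subtype_le _ _
  have hst : ∀ g : G, ∀ w ∈ W, permRep k G X g w ∈ W := by
    rintro g _ ⟨v, hv, rfl⟩
    exact ⟨augmentationRep k G X g v, S.apply_mem_toSubmodule g hv, rfl⟩
  rcases eq_or_ne W ⊥ with h | h
  · left
    apply Subrepresentation.toSubmodule_injective
    change S.toSubmodule = ⊥
    rw [← Submodule.map_bot (augmentationSubmodule k X).subtype] at h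
    exact Submodule.map_injective_of_injective (augmentationSubmodule k X).injective_subtype h
  · right
    apply Subrepresentation.toSubmodule_injective
    change S.toSubmodule = ⊤
    have hWeq := eq_augmentationSubmodule_of_kleinStable h2 hd hcov h₁ h₂ h₃ hW hst h
    rw [← Submodule.range_subtype (augmentationSubmodule k X), ← Submodule.map_top] at hWeq
    exact Submodule.map_injective_of_injective (augmentationSubmodule k X).injective_subtype hWeq

/-- **The sum-zero module of four points is irreducible once the image contains `A₄`
(characteristic `≠ 2`).** For a field `k` with `2 ≠ 0`, a `G`-set `X` with `#X = 4` such that the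
image of `G → Sym(X)` contains the alternating group, the augmentation representation of `G` on
`(k^X)⁰` (dimension `3`) is irreducible.  Since the hypothesis is insensitive to extending `k`, this
is absolute irreducibility; with `k ⊇ 𝔽₃`, `X` = the four roots of the quartic `f` and `G = Γ_K`
(image `⊇ A₄` when `12 ∣ #Gal(f/ℚ)`), it is the irreducibility of the Schaefer–Zarhin module
`(𝔽₃^{roots f})⁰ ≅ J_f[1 - ω]` invoked by the RESIDUAL IRREDUCIBILITY clause of
`picardCurve_exists_lambdaAdicRep`.  Reduction to `augmentationRep_isIrreducible_of_kleinConfig`: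
label `X ≃ Fin 4` and lift the even permutations `(a b)(c d)`, `(a c)(b d)`, `(b c d) = (b c)(c d)`
to `G`. (Cf. Zarhin 2018 Lemma 7.4 (i), Mortimer 1980.) [folklore] -/
theorem augmentationRep_isIrreducible_of_alternatingGroup_le (h2 : (2 : k) ≠ 0) [Fintype X]
    (hX : Fintype.card X = 4)
    (hA : alternatingGroup X ≤ (MulAction.toPermHom G X).range) :
    Representation.IsIrreducible (k := k) (G := G) (V := augmentationSubmodule k X)
      (augmentationRep k G X) := by
  obtain ⟨e⟩ : Nonempty (X ≃ Fin 4) := ⟨Fintype.equivFinOfCardEq hX⟩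
  set a := e.symm 0 with ha
  set b := e.symm 1 with hb
  set c := e.symm 2 with hc
  set d := e.symm 3 with hd'
  have hab : a ≠ b := e.symm.injective.ne (by decide)
  have hac : a ≠ c := e.symm.injective.ne (by decide)
  have had : a ≠ d := e.symm.injective.ne (by decide)
  have hbc : b ≠ c := e.symm.injective.ne (by decide)
  have hbd : b ≠ d := e.symm.injective.ne (by decide)
  have hcd : c ≠ d := e.symm.injective.ne (by decide)
  have hcov : ∀ x : X, x = a ∨ x = b ∨ x = c ∨ x = d := by
    intro x
    obtain ⟨i, rfl⟩ := e.symm.surjective x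
    fin_cases i
    · exact Or.inl rfl
    · exact Or.inr (Or.inl rfl)
    · exact Or.inr (Or.inr (Or.inl rfl))
    · exact Or.inr (Or.inr (Or.inr rfl))
  -- the three even permutations `(a b)(c d)`, `(a c)(b d)`, `(b c d)` and lifts to `G`
  have hsign : ∀ {x y z w : X}, x ≠ y → z ≠ w →
      Equiv.swap x y * Equiv.swap z w ∈ alternatingGroup X := by
    intro x y z w hxy hzw
    rw [Equiv.Perm.mem_alternatingGroup, Equiv.Perm.sign_mul, Equiv.Perm.sign_swap hxy,
      Equiv.Perm.sign_swap hzw]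
    decide
  have lift : ∀ σ ∈ alternatingGroup X, ∃ g : G, ∀ x : X, g • x = σ x := by
    intro σ hσ
    obtain ⟨g, hg⟩ := hA hσ
    exact ⟨g, fun x => by rw [← MulAction.toPerm_apply, ← MulAction.toPermHom_apply, hg]⟩
  obtain ⟨g₁, hg₁⟩ := lift _ (hsign hab hcd)
  obtain ⟨g₂, hg₂⟩ := lift _ (hsign hac hbd)
  obtain ⟨g₃, hg₃⟩ := lift _ (hsign hbc hcd)
  refine augmentationRep_isIrreducible_of_kleinConfig h2 ⟨hab, hac, had, hbc, hbd, hcd⟩ hcov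
    (g₁ := g₁) (g₂ := g₂) (g₃ := g₃) ⟨?_, ?_, ?_, ?_⟩ ⟨?_, ?_, ?_, ?_⟩ ⟨?_, ?_, ?_, ?_⟩
  · rw [hg₁, Equiv.Perm.mul_apply, Equiv.swap_apply_of_ne_of_ne hac had, Equiv.swap_apply_left]
  · rw [hg₁, Equiv.Perm.mul_apply, Equiv.swap_apply_of_ne_of_ne hbc hbd, Equiv.swap_apply_right]
  · rw [hg₁, Equiv.Perm.mul_apply, Equiv.swap_apply_left,
      Equiv.swap_apply_of_ne_of_ne had.symm hbd.symm]
  · rw [hg₁, Equiv.Perm.mul_apply, Equiv.swap_apply_right,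
      Equiv.swap_apply_of_ne_of_ne hac.symm hbc.symm]
  · rw [hg₂, Equiv.Perm.mul_apply, Equiv.swap_apply_of_ne_of_ne hab had, Equiv.swap_apply_left]
  · rw [hg₂, Equiv.Perm.mul_apply, Equiv.swap_apply_left,
      Equiv.swap_apply_of_ne_of_ne had.symm hcd.symm]
  · rw [hg₂, Equiv.Perm.mul_apply, Equiv.swap_apply_of_ne_of_ne hbc.symm hcd,
      Equiv.swap_apply_right]
  · rw [hg₂, Equiv.Perm.mul_apply, Equiv.swap_apply_right,
      Equiv.swap_apply_of_ne_of_ne hab.symm hbc]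
  · rw [hg₃, Equiv.Perm.mul_apply, Equiv.swap_apply_of_ne_of_ne hac had,
      Equiv.swap_apply_of_ne_of_ne hab hac]
  · rw [hg₃, Equiv.Perm.mul_apply, Equiv.swap_apply_of_ne_of_ne hbc hbd, Equiv.swap_apply_left]
  · rw [hg₃, Equiv.Perm.mul_apply, Equiv.swap_apply_left,
      Equiv.swap_apply_of_ne_of_ne hbd.symm hcd.symm]
  · rw [hg₃, Equiv.Perm.mul_apply, Equiv.swap_apply_right, Equiv.swap_apply_right]

end HeartA4

/-! ## The image of `Γ_{ℚ(ω)}` on the roots of a generic quartic contains `A₄`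

The hypothesis of `augmentationRep_isIrreducible_of_alternatingGroup_le` for `G = Γ_K`, `K = ℚ(ω)`,
`X` = the four roots of `f` in `K̄`, when `12 ∣ #Gal(f/ℚ)` (i.e. `Gal(f/ℚ) ∈ {A₄, S₄}`): first two
lemmas on permutation groups of `4` letters, then the Galois-theoretic transfer from `Gal(K̄/ℚ)` to
its index-`2` subgroup `Γ_K` through squares. -/

section GroupTheory

/-- In a permutation group, a subgroup `H` containing the square of every element of a subgroup
`R ⊇ Alt(X)` contains `Alt(X)`: every `3`-cycle `c` satisfies `c = (c²)²` with `c² ∈ Alt(X) ≤ R`,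
and `3`-cycles generate the alternating group (Mathlib `closure_three_cycles_eq_alternating`).
[folklore] -/
theorem alternatingGroup_le_of_sq_mem {X : Type*} [Fintype X] [DecidableEq X]
    {R H : Subgroup (Equiv.Perm X)} (hR : alternatingGroup X ≤ R)
    (hsq : ∀ r ∈ R, r ^ 2 ∈ H) : alternatingGroup X ≤ H := by
  rw [← Equiv.Perm.closure_three_cycles_eq_alternating, Subgroup.closure_le]
  intro c hc
  have hc3 : c ^ 3 = 1 := by
    rw [← (Equiv.Perm.IsThreeCycle.orderOf hc)]
    exact pow_orderOf_eq_one c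
  have hcA : c ∈ alternatingGroup X := Equiv.Perm.IsThreeCycle.mem_alternatingGroup hc
  have h4 : (c ^ 2) ^ 2 ∈ H := hsq _ (R.pow_mem (hR hcA) 2)
  have : (c ^ 2) ^ 2 = c := by
    rw [← pow_mul]
    calc c ^ (2 * 2) = c ^ 3 * c := by rw [← pow_succ]
      _ = c := by rw [hc3, one_mul]
  rwa [this] at h4

/-- A subgroup of the symmetric group on `4` letters whose order is divisible by `12` contains the
alternating group (it has index `≤ 2`; Mathlib `alternatingGroup_le_of_index_le_two`). [folklore] -/
theorem alternatingGroup_le_of_card_eq_four_of_twelve_dvd {X : Type*} [Fintype X] [DecidableEq X]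
    (hX : Fintype.card X = 4) {R : Subgroup (Equiv.Perm X)} (h12 : 12 ∣ Nat.card R) :
    alternatingGroup X ≤ R := by
  apply Equiv.Perm.alternatingGroup_le_of_index_le_two
  have hG : Nat.card (Equiv.Perm X) = 24 := by
    rw [Nat.card_eq_fintype_card, Fintype.card_perm, hX]; rfl
  have hmul : R.index * Nat.card R = 24 := by rw [Subgroup.index_mul_card, hG]
  obtain ⟨m, hm⟩ := h12
  have hm0 : 0 < m := by
    rcases Nat.eq_zero_or_pos m with rfl | h
    · rw [mul_zero] at hm; rw [hm, mul_zero] at hmul; exact absurd hmul (by norm_num)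
    · exact h
  have : R.index * m = 2 := by
    have h' : R.index * m * 12 = 2 * 12 := by
      calc R.index * m * 12 = R.index * (12 * m) := by ring
        _ = 24 := by rw [← hm, hmul]
        _ = 2 * 12 := by norm_num
    exact Nat.eq_of_mul_eq_mul_right (by norm_num) h'
  calc R.index ≤ R.index * m := Nat.le_mul_of_pos_right _ hm0
    _ = 2 := this

end GroupTheory

/-! ## Irreducibility of the sum-zero module of the roots for `Γ_{ℚ(ω)}`

Stated for any number field `K` with `IsCyclotomicExtension {3} ℚ K` (any model of `ℚ(ω)`); for the
concrete `CyclotomicField 3 ℚ` of `picardCurve_exists_lambdaAdicRep` the instance is supplied by hand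
as in `exists_isPrimitiveRoot_three_cyclotomicField`. -/

section PicardRootsImage

variable {K : Type*} [Field K] [NumberField K]

/-- `K̄` is a normal extension of `ℚ` for a number field `K` (algebraic over `ℚ` and algebraically
closed), for the `ℚ`-algebra structure of `K̄` as a field of characteristic zero. [folklore] -/
theorem normal_rat_algebraicClosure : Normal ℚ (AlgebraicClosure K) := by
  haveI : Algebra.IsAlgebraic ℚ (AlgebraicClosure K) :=
    Algebra.IsAlgebraic.trans ℚ K (AlgebraicClosure K)
  exact normal_iff.2 fun x =>
    ⟨(Algebra.IsAlgebraic.isAlgebraic x).isIntegral, IsAlgClosed.splits _⟩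

/-- Every `ℚ`-automorphism `σ` of `K̄`, `K = ℚ(ω)`, satisfies `σ² = 1` on `K`: `σ` restricts to
`Gal(K/ℚ)`, a group of order `[K : ℚ] = φ(3) = 2`. [folklore] -/
theorem apply_apply_algebraMap_of_isCyclotomicExtension_three [IsCyclotomicExtension {3} ℚ K]
    (σ : AlgebraicClosure K ≃ₐ[ℚ] AlgebraicClosure K) (k : K) :
    σ (σ (algebraMap K (AlgebraicClosure K) k)) = algebraMap K (AlgebraicClosure K) k := by
  haveI : IsGalois ℚ K := IsCyclotomicExtension.isGalois {3} ℚ K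
  have h1 : ∀ x : K, σ (algebraMap K (AlgebraicClosure K) x) =
      algebraMap K (AlgebraicClosure K) (σ.restrictNormal K x) :=
    fun x => (AlgEquiv.restrictNormal_commutes σ K x).symm
  have hcard : Nat.card (K ≃ₐ[ℚ] K) = 2 := by
    rw [IsGalois.card_aut_eq_finrank, IsCyclotomicExtension.finrank (n := 3) K
      (Polynomial.cyclotomic.irreducible_rat (by norm_num))]
    decide
  have hsq : σ.restrictNormal K ^ 2 = 1 := by
    rw [← hcard]; exact pow_card_eq_one'
  rw [h1, h1, ← AlgEquiv.mul_apply, ← sq, hsq, AlgEquiv.one_apply]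

/-- The roots in `K̄` of an integer polynomial and of its image in `ℚ[X]` coincide. [folklore] -/
theorem rootSet_eq_rootSet_map_int (f : ℤ[X]) :
    f.rootSet (AlgebraicClosure K) = (f.map (Int.castRingHom ℚ)).rootSet (AlgebraicClosure K) := by
  rw [rootSet_def, rootSet_def, aroots_def, aroots_def, Polynomial.map_map]
  congr
  exact RingHom.ext_int _ _

/-- The roots of an integer quartic, separable over `ℚ`, in `K̄` number `4`. [folklore] -/
theorem card_rootSet_eq_four {f : ℤ[X]} (h4 : f.natDegree = 4)
    (hsep : (f.map (Int.castRingHom ℚ)).Separable) :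
    Fintype.card (f.rootSet (AlgebraicClosure K)) = 4 := by
  rw [Fintype.card_congr (Equiv.setCongr (rootSet_eq_rootSet_map_int (K := K) f)),
    card_rootSet_eq_natDegree hsep (IsAlgClosed.splits _),
    natDegree_map_eq_of_injective (Int.castRingHom ℚ).injective_int, h4]

/-- **The Galois group of `K = ℚ(ω)` induces at least the alternating group on the four roots of a
quartic with `Gal(f/ℚ) ∈ {A₄, S₄}`.**  For `f ∈ ℤ[X]` of degree `4`, separable over `ℚ`, with
`12 ∣ #Gal(f/ℚ)`, and `K` the third cyclotomic field, the image of `Γ_K = Gal(K̄/K)` in the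
permutations of the roots of `f` in `K̄` contains the alternating group: `Gal(f/ℚ) ↪ Sym(roots)` has
order divisible by `12`, hence contains `A₄` (index `≤ 2`); every `σ ∈ Gal(K̄/ℚ)` has `σ² ∈ Γ_K`
(`[K : ℚ] = 2`), so the image of `Γ_K` contains all squares of `Gal(f/ℚ)`, in particular every
`3`-cycle `c = (c²)²`, and `3`-cycles generate `A₄`.  This is the hypothesis of
`augmentationRep_isIrreducible_of_alternatingGroup_le` for the Schaefer–Zarhin module
`(𝔽₃^{roots f})⁰ ≅ J_f[1 - ω]` (RESIDUAL IRREDUCIBILITY clause of `picardCurve_exists_lambdaAdicRep`;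
Zarhin 2018 §8 (0)–(i): `Γ_K` acts on `J^{(f,q)}_λ ≅ (𝔽_p^{R_f})⁰` through `Gal(f)`).
[cite: Zarhin2018SuperellipticJacobians, §8 (i) (arXiv p. 22)] -/
theorem alternatingGroup_le_range_toPermHom_rootSet [IsCyclotomicExtension {3} ℚ K] (f : ℤ[X])
    (h4 : f.natDegree = 4) (hsep : (f.map (Int.castRingHom ℚ)).Separable)
    (h12 : 12 ∣ Nat.card (f.map (Int.castRingHom ℚ)).Gal) :
    alternatingGroup (f.rootSet (AlgebraicClosure K)) ≤
      (MulAction.toPermHom (absoluteGaloisGroup K) (f.rootSet (AlgebraicClosure K))).range := by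
  set p : ℚ[X] := f.map (Int.castRingHom ℚ) with hp
  haveI hsplit : Fact ((p.map (algebraMap ℚ (AlgebraicClosure K))).Splits) :=
    ⟨IsAlgClosed.splits _⟩
  haveI : Normal ℚ (AlgebraicClosure K) := normal_rat_algebraicClosure
  -- the roots of `f` and of `p` in `K̄` coincide
  set e : f.rootSet (AlgebraicClosure K) ≃ p.rootSet (AlgebraicClosure K) :=
    Equiv.setCongr (rootSet_eq_rootSet_map_int (K := K) f) with he
  -- `Gal(p/ℚ) ↪ Sym(roots)`
  set ι : p.Gal →* Equiv.Perm (f.rootSet (AlgebraicClosure K)) :=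
    e.symm.permCongrHom.toMonoidHom.comp (Gal.galActionHom p (AlgebraicClosure K)) with hι
  have hιinj : Function.Injective ι :=
    e.symm.permCongrHom.injective.comp (Gal.galActionHom_injective p (AlgebraicClosure K))
  have hιapply : ∀ (σ : AlgebraicClosure K ≃ₐ[ℚ] AlgebraicClosure K)
      (x : f.rootSet (AlgebraicClosure K)),
      ((ι (Gal.restrict p (AlgebraicClosure K) σ) x : f.rootSet (AlgebraicClosure K)) :
        AlgebraicClosure K) = σ x := by
    intro σ x
    show ((Gal.galActionHom p (AlgebraicClosure K) (Gal.restrict p (AlgebraicClosure K) σ) (e x) :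
      p.rootSet (AlgebraicClosure K)) : AlgebraicClosure K) = σ x
    rw [Gal.galActionHom_restrict]
    rfl
  -- its image has order `#Gal(p/ℚ)`, divisible by `12`, hence contains `A₄`
  have hR : alternatingGroup (f.rootSet (AlgebraicClosure K)) ≤ ι.range := by
    apply alternatingGroup_le_of_card_eq_four_of_twelve_dvd (card_rootSet_eq_four h4 hsep)
    rwa [← Nat.card_congr (MonoidHom.ofInjective hιinj).toEquiv]
  -- squares of `Gal(p/ℚ)` come from `Γ_K`
  refine alternatingGroup_le_of_sq_mem hR ?_
  rintro _ ⟨g, rfl⟩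
  obtain ⟨σ, rfl⟩ := Gal.restrict_surjective p (AlgebraicClosure K) g
  let τ' : AlgebraicClosure K ≃ₐ[K] AlgebraicClosure K :=
    AlgEquiv.ofRingEquiv (f := ((σ * σ : AlgebraicClosure K ≃ₐ[ℚ] AlgebraicClosure K) :
        AlgebraicClosure K ≃+* AlgebraicClosure K)) fun k => by
      simpa using apply_apply_algebraMap_of_isCyclotomicExtension_three σ k
  refine ⟨(Field.absoluteGaloisGroup.toAlgEquiv K).symm τ', ?_⟩
  ext x
  rw [MulAction.toPermHom_apply, MulAction.toPerm_apply, rootSet.coe_smul,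
    Field.absoluteGaloisGroup.toAlgEquiv_symm_apply, sq, Equiv.Perm.mul_apply, hιapply, hιapply]
  simp [τ']

/-- **The sum-zero module of the roots of a generic quartic is (absolutely) irreducible for
`Γ_{ℚ(ω)}`.**  For `f ∈ ℤ[X]` of degree `4`, separable over `ℚ`, with `12 ∣ #Gal(f/ℚ)`, `K` the third
cyclotomic field and ANY field `k` of characteristic `≠ 2`, the augmentation representation of `Γ_K`
on `(k^{roots of f in K̄})⁰` is irreducible; for `k ⊇ 𝔽₃` this is the absolute irreducibility of
the Schaefer–Zarhin model `(𝔽₃^{R_f})⁰` of `J_f[1 - ω]` (Zarhin 2018 §8 (i)) — the representation-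
theoretic content of the RESIDUAL IRREDUCIBILITY clause of `picardCurve_exists_lambdaAdicRep`
(what it does not cover is the geometric comparison `ρ̄ ≅ (𝔽₃^{R_f})⁰ ⊗ 𝔽̄₃`).
[cite: Zarhin2018SuperellipticJacobians, §8 (i) (arXiv p. 22)] -/
theorem augmentationRep_rootSet_isIrreducible [IsCyclotomicExtension {3} ℚ K] (f : ℤ[X])
    (h4 : f.natDegree = 4) (hsep : (f.map (Int.castRingHom ℚ)).Separable)
    (h12 : 12 ∣ Nat.card (f.map (Int.castRingHom ℚ)).Gal) {k : Type*} [Field k]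
    (h2 : (2 : k) ≠ 0) :
    Representation.IsIrreducible (k := k) (G := absoluteGaloisGroup K)
      (V := augmentationSubmodule k (f.rootSet (AlgebraicClosure K)))
      (augmentationRep k (absoluteGaloisGroup K) (f.rootSet (AlgebraicClosure K))) :=
  augmentationRep_isIrreducible_of_alternatingGroup_le h2 (card_rootSet_eq_four h4 hsep)
    (alternatingGroup_le_range_toPermHom_rootSet f h4 hsep h12)

end PicardRootsImage


/-! ## The `(1 - ω)`-torsion of the Jacobian of the Picard curve (RESIDUAL IRREDUCIBILITY, geometric module)

For `f ∈ ℤ[X]` a quartic separable over `ℚ` and any field `K ⊇ ℚ(ω)` (`IsCyclotomicExtension {3} ℚ K`,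
e.g. the `CyclotomicField 3 ℚ` of the fact), the curve `C_f : y³ = f(x)` is the superelliptic curve
`SuperellipticFunctionField K K̄ 3 f_K`, `f_K = f ⊗ K`, of the tree (`3` prime, `ζ₃ ∈ K`, `f_K`
separable of degree `4`, `3 ∤ 4`), so `superelliptic_lambdaTorsion_iso_heart_of_not_dvd` applies:
`J_f[1 - ω] ≅ Heart 3 (roots f) = (𝔽₃^{roots f})⁰`, `Γ_K`-equivariantly. -/

section PicardLambdaTorsion

variable (K : Type*) [Field K] [CharZero K]

/-- `deg f_K = 4` for an integer quartic `f`. [folklore] -/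
theorem natDegree_map_algebraMap_int_eq {f : ℤ[X]} (h4 : f.natDegree = 4) :
    (f.map (algebraMap ℤ K)).natDegree = 4 := by
  rw [natDegree_map_eq_of_injective (algebraMap ℤ K).injective_int, h4]

/-- `f_K` is separable when `f` is separable over `ℚ` (`f_K = f_ℚ ⊗ K`). [folklore] -/
theorem separable_map_algebraMap_int {f : ℤ[X]} (hsep : (f.map (Int.castRingHom ℚ)).Separable) :
    (f.map (algebraMap ℤ K)).Separable := by
  have h : f.map (algebraMap ℤ K) = (f.map (Int.castRingHom ℚ)).map (algebraMap ℚ K) := by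
    rw [Polynomial.map_map]
    congr 1
    exact RingHom.ext_int _ _
  rw [h]
  exact hsep.map

omit [CharZero K] in
/-- The roots of `f_K` in `K̄` are the roots of `f`. [folklore] -/
theorem rootSet_map_algebraMap_int (f : ℤ[X]) :
    (f.map (algebraMap ℤ K)).rootSet (AlgebraicClosure K) = f.rootSet (AlgebraicClosure K) := by
  have h : (algebraMap K (AlgebraicClosure K)).comp (algebraMap ℤ K) = algebraMap ℤ (AlgebraicClosure K) :=
    RingHom.ext_int _ _
  rw [rootSet_def, rootSet_def, aroots_def, aroots_def, Polynomial.map_map, h]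

/-- `#(roots of f_K in K̄) = 4` for an integer quartic separable over `ℚ`. [folklore] -/
theorem card_rootSet_map_algebraMap_int {f : ℤ[X]} (h4 : f.natDegree = 4)
    (hsep : (f.map (Int.castRingHom ℚ)).Separable) :
    Fintype.card ((f.map (algebraMap ℤ K)).rootSet (AlgebraicClosure K)) = 4 := by
  rw [card_rootSet_eq_natDegree (separable_map_algebraMap_int K hsep) (IsAlgClosed.splits _),
    natDegree_map_algebraMap_int_eq K h4]

/-- `3 ∤ #(roots of f_K)` — the heart of `𝔽₃^{roots}` is the whole sum-zero module
(`augmentationEquivHeart`). [folklore] -/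
theorem not_three_dvd_card_rootSet {f : ℤ[X]} (h4 : f.natDegree = 4)
    (hsep : (f.map (Int.castRingHom ℚ)).Separable) :
    ¬ 3 ∣ Fintype.card ((f.map (algebraMap ℤ K)).rootSet (AlgebraicClosure K)) := by
  rw [card_rootSet_map_algebraMap_int K h4 hsep]
  decide

/-- `K̄(C_f)`, `C_f : y³ = f_K(x)`, is a field: `Y³ - f_K(x)` is irreducible over `K̄(x)` (the `Fact`
of the superelliptic files, for use with `haveI`). [folklore] -/
theorem fact_irreducible_superellipticPoly_picard {f : ℤ[X]} (h4 : f.natDegree = 4)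
    (hsep : (f.map (Int.castRingHom ℚ)).Separable) :
    Fact (Irreducible (superellipticPoly K (AlgebraicClosure K) 3 (f.map (algebraMap ℤ K)))) :=
  fact_irreducible_superellipticPoly_algebraicClosure K (f.map (algebraMap ℤ K))
    (separable_map_algebraMap_int K hsep) (by rw [natDegree_map_algebraMap_int_eq K h4]; norm_num)

variable [IsCyclotomicExtension {3} ℚ K]

/-- `K ⊇ ℚ(ω)` contains a primitive cube root of unity. [folklore] -/
theorem exists_isPrimitiveRoot_three_of_isCyclotomicExtension : ∃ ζ : K, IsPrimitiveRoot ζ 3 :=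
  ⟨IsCyclotomicExtension.zeta 3 ℚ K, IsCyclotomicExtension.zeta_spec 3 ℚ K⟩

/-- **`J_f[1 - ω] ≅ (𝔽₃^{roots f})⁰` for the Picard curve `y³ = f(x)`** (Schaefer 1998 Prop. 3.2;
Zarhin 2018 §8 (i); the case `p = 3 ∤ 4 = deg f` of `superelliptic_lambdaTorsion_iso_heart_of_not_dvd`).
For `f ∈ ℤ[X]` a quartic separable over `ℚ` and `K ⊇ ℚ(ω)`: there is an injective additive map
`Ψ` from the heart of `𝔽₃^{R}`, `R` the four roots of `f` in `K̄` (`= (𝔽₃^R)⁰`, as `3 ∤ 4`: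
`augmentationEquivHeart 3 R (not_three_dvd_card_rootSet K h4 hsep)`), onto
`J_f[1 - ω] = geomLambdaTorsion K 3 f_K` — the degree-zero divisor classes of `K̄(C_f)` fixed by the
deck transformation `y ↦ ω y` — which is `Γ_K`-equivariant (`Ψ [a] = [∑_α ã_α ((α, 0) - ∞)]`).  This is
the geometric module of the RESIDUAL IRREDUCIBILITY clause of `picardCurve_exists_lambdaAdicRep`; with
`augmentationRep_rootSet_isIrreducible` (transported along `rootSet_map_algebraMap_int`) it is
absolutely irreducible for `12 ∣ #Gal(f/ℚ)`.
[cite: Schaefer1998, §3 Prop. 3.2] [cite: Zarhin2018SuperellipticJacobians, §8 (i) (arXiv p. 22)] -/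
theorem picard_lambdaTorsion_iso_heart (f : ℤ[X]) (h4 : f.natDegree = 4)
    (hsep : (f.map (Int.castRingHom ℚ)).Separable) :
    haveI := fact_irreducible_superellipticPoly_picard K h4 hsep
    ∃ Ψ : Heart 3 ((f.map (algebraMap ℤ K)).rootSet (AlgebraicClosure K)) →+
        GeomPic K 3 (f.map (algebraMap ℤ K)),
      Function.Injective Ψ ∧
      Ψ.range = geomLambdaTorsion K 3 (f.map (algebraMap ℤ K)) ∧
      ∀ (σ : absoluteGaloisGroup K) (v : Heart 3 ((f.map (algebraMap ℤ K)).rootSet (AlgebraicClosure K))),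
        Ψ (heartRep 3 ((f.map (algebraMap ℤ K)).rootSet (AlgebraicClosure K)) (absoluteGaloisGroup K) σ v) =
          σ • Ψ v := by
  haveI := fact_irreducible_superellipticPoly_picard K h4 hsep
  exact superelliptic_lambdaTorsion_iso_heart_of_not_dvd K 3 (f.map (algebraMap ℤ K))
    (exists_isPrimitiveRoot_three_of_isCyclotomicExtension K) (separable_map_algebraMap_int K hsep)
    (by rw [natDegree_map_algebraMap_int_eq K h4]; decide)

/-- **`J_f[1 - ω] ⊆ J_f[3]`** for the Picard curve: the `(1 - ω)`-torsion classes are `3`-torsion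
(`(1 - ω)² = -3ω`; here from `lambdaTorsion_le_jacobianTorsion_of_not_dvd`).
[cite: Zarhin2018SuperellipticJacobians, §8] -/
theorem picard_lambdaTorsion_le_jacobianTorsion (f : ℤ[X]) (h4 : f.natDegree = 4)
    (hsep : (f.map (Int.castRingHom ℚ)).Separable) :
    haveI := fact_irreducible_superellipticPoly_picard K h4 hsep
    geomLambdaTorsion K 3 (f.map (algebraMap ℤ K)) ≤ geomJacobianTorsion K 3 (f.map (algebraMap ℤ K)) 3 := by
  haveI := fact_irreducible_superellipticPoly_picard K h4 hsep
  obtain ⟨ζ, hζ⟩ := exists_isPrimitiveRoot_three_of_isCyclotomicExtension K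
  exact SuperellipticFunctionField.lambdaTorsion_le_jacobianTorsion_of_not_dvd
    (hζ.map_of_injective (algebraMap K (AlgebraicClosure K)).injective)
    (separable_map_algebraMap_int K hsep) (by rw [natDegree_map_algebraMap_int_eq K h4]; decide)

end PicardLambdaTorsion

/-! ### `(𝔽_p^Ω)⁰ ≃ Heart` as an equivalence of representations (`p ∤ |Ω|`) -/

section HeartEquiv

variable (p : ℕ) [Fact p.Prime] (Ω : Type*) [Fintype Ω]

/-- **`(𝔽_p^Ω)⁰ ≃ Heart` as an equivalence of representations** of any group `G` permuting `Ω`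
(`p ∤ |Ω|`): the tree's linear isomorphism `augmentationEquivHeart` (`SuperellipticLambdaTorsionCoprime`)
intertwines `augmentationRep` and `heartRep` (Mathlib `Representation.Equiv`), so that irreducibility
passes between the two (tree `Representation.isIrreducible_of_equiv`). [cite: Zarhin2018SuperellipticJacobians, §7] -/
noncomputable def augmentationRepEquivHeartRep (hndvd : ¬ p ∣ Fintype.card Ω) (G : Type*) [Group G] [MulAction G Ω] :
    (augmentationRep (ZMod p) G Ω).Equiv (heartRep p Ω G) :=
  Representation.Equiv.mk (augmentationEquivHeart p Ω hndvd) fun g =>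
    LinearMap.ext fun x => augmentationEquivHeart_augmentationRep p Ω hndvd g x

/-- `augmentationRepEquivHeartRep x = [x]`. [folklore] -/
@[simp]
theorem augmentationRepEquivHeartRep_apply (hndvd : ¬ p ∣ Fintype.card Ω) (G : Type*) [Group G] [MulAction G Ω]
    (x : augmentationSubmodule (ZMod p) Ω) :
    augmentationRepEquivHeartRep p Ω hndvd G x = Submodule.Quotient.mk x :=
  rfl

end HeartEquiv

/-! ### The Galois image on the roots of `f_K` and irreducibility of the heart over `𝔽₃`

The `K[X]`-form `f_K.rootSet K̄` of the root set (the one the superelliptic files see) carries the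
same `Γ_K`-set structure as `f.rootSet K̄`; we rerun the argument of
`alternatingGroup_le_range_toPermHom_rootSet` for it and deduce the irreducibility of the heart,
i.e. of the `𝔽₃[Γ_K]`-module `J_f[1 - ω]`, for generic `f`. -/

section PicardHeartIrreducible

variable {K : Type*} [Field K] [NumberField K] [IsCyclotomicExtension {3} ℚ K]

omit [IsCyclotomicExtension {3} ℚ K] in
/-- The roots of `f_K` in `K̄` are the roots of `f_ℚ = f ⊗ ℚ`. [folklore] -/
theorem rootSet_map_algebraMap_int_eq_rootSet_map_rat (f : ℤ[X]) :
    (f.map (algebraMap ℤ K)).rootSet (AlgebraicClosure K) =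
      (f.map (Int.castRingHom ℚ)).rootSet (AlgebraicClosure K) := by
  rw [rootSet_map_algebraMap_int K f, rootSet_eq_rootSet_map_int]

/-- **`Γ_K` induces at least `A₄` on the four roots of `f_K`** for `12 ∣ #Gal(f/ℚ)` — the statement of
`alternatingGroup_le_range_toPermHom_rootSet` for the root set of `f_K ∈ K[X]` (same proof: the roots
of `f_K` and of `f_ℚ` in `K̄` coincide, `Gal(f_ℚ/ℚ) ↪ Sym(roots)` has order divisible by `12`, and squares
of `Gal(K̄/ℚ)` lie in `Γ_K`). [cite: Zarhin2018SuperellipticJacobians, §8 (i) (arXiv p. 22)] -/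
theorem alternatingGroup_le_range_toPermHom_rootSet_map (f : ℤ[X])
    (h4 : f.natDegree = 4) (hsep : (f.map (Int.castRingHom ℚ)).Separable)
    (h12 : 12 ∣ Nat.card (f.map (Int.castRingHom ℚ)).Gal) :
    alternatingGroup ((f.map (algebraMap ℤ K)).rootSet (AlgebraicClosure K)) ≤
      (MulAction.toPermHom (absoluteGaloisGroup K)
        ((f.map (algebraMap ℤ K)).rootSet (AlgebraicClosure K))).range := by
  set p : ℚ[X] := f.map (Int.castRingHom ℚ) with hp
  set fK : K[X] := f.map (algebraMap ℤ K) with hfK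
  haveI hsplit : Fact ((p.map (algebraMap ℚ (AlgebraicClosure K))).Splits) :=
    ⟨IsAlgClosed.splits _⟩
  haveI : Normal ℚ (AlgebraicClosure K) := normal_rat_algebraicClosure
  -- the roots of `f_K` and of `p` in `K̄` coincide
  set e : fK.rootSet (AlgebraicClosure K) ≃ p.rootSet (AlgebraicClosure K) :=
    Equiv.setCongr (rootSet_map_algebraMap_int_eq_rootSet_map_rat (K := K) f) with he
  -- `Gal(p/ℚ) ↪ Sym(roots)`
  set ι : p.Gal →* Equiv.Perm (fK.rootSet (AlgebraicClosure K)) :=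
    e.symm.permCongrHom.toMonoidHom.comp (Gal.galActionHom p (AlgebraicClosure K)) with hι
  have hιinj : Function.Injective ι :=
    e.symm.permCongrHom.injective.comp (Gal.galActionHom_injective p (AlgebraicClosure K))
  have hιapply : ∀ (σ : AlgebraicClosure K ≃ₐ[ℚ] AlgebraicClosure K)
      (x : fK.rootSet (AlgebraicClosure K)),
      ((ι (Gal.restrict p (AlgebraicClosure K) σ) x : fK.rootSet (AlgebraicClosure K)) :
        AlgebraicClosure K) = σ x := by
    intro σ x
    show ((Gal.galActionHom p (AlgebraicClosure K) (Gal.restrict p (AlgebraicClosure K) σ) (e x) :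
      p.rootSet (AlgebraicClosure K)) : AlgebraicClosure K) = σ x
    rw [Gal.galActionHom_restrict]
    rfl
  -- its image has order `#Gal(p/ℚ)`, divisible by `12`, hence contains `A₄`
  have hR : alternatingGroup (fK.rootSet (AlgebraicClosure K)) ≤ ι.range := by
    apply alternatingGroup_le_of_card_eq_four_of_twelve_dvd (card_rootSet_map_algebraMap_int K h4 hsep)
    rwa [← Nat.card_congr (MonoidHom.ofInjective hιinj).toEquiv]
  -- squares of `Gal(p/ℚ)` come from `Γ_K`
  refine alternatingGroup_le_of_sq_mem hR ?_
  rintro _ ⟨g, rfl⟩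
  obtain ⟨σ, rfl⟩ := Gal.restrict_surjective p (AlgebraicClosure K) g
  let τ' : AlgebraicClosure K ≃ₐ[K] AlgebraicClosure K :=
    AlgEquiv.ofRingEquiv (f := ((σ * σ : AlgebraicClosure K ≃ₐ[ℚ] AlgebraicClosure K) :
        AlgebraicClosure K ≃+* AlgebraicClosure K)) fun k => by
      simpa using apply_apply_algebraMap_of_isCyclotomicExtension_three σ k
  refine ⟨(Field.absoluteGaloisGroup.toAlgEquiv K).symm τ', ?_⟩
  ext x
  rw [MulAction.toPermHom_apply, MulAction.toPerm_apply, rootSet.coe_smul,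
    Field.absoluteGaloisGroup.toAlgEquiv_symm_apply, sq, Equiv.Perm.mul_apply, hιapply, hιapply]
  simp [τ']

/-- **The sum-zero module of the roots of `f_K` is irreducible for `Γ_K`** over every field of
characteristic `≠ 2` (generic `f`): `augmentationRep_rootSet_isIrreducible` for the root set of `f_K`.
[cite: Zarhin2018SuperellipticJacobians, §8 (i) (arXiv p. 22)] -/
theorem augmentationRep_rootSet_map_isIrreducible (f : ℤ[X])
    (h4 : f.natDegree = 4) (hsep : (f.map (Int.castRingHom ℚ)).Separable)
    (h12 : 12 ∣ Nat.card (f.map (Int.castRingHom ℚ)).Gal) {k : Type*} [Field k]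
    (h2 : (2 : k) ≠ 0) :
    Representation.IsIrreducible (k := k) (G := absoluteGaloisGroup K)
      (V := augmentationSubmodule k ((f.map (algebraMap ℤ K)).rootSet (AlgebraicClosure K)))
      (augmentationRep k (absoluteGaloisGroup K) ((f.map (algebraMap ℤ K)).rootSet (AlgebraicClosure K))) :=
  augmentationRep_isIrreducible_of_alternatingGroup_le h2 (card_rootSet_map_algebraMap_int K h4 hsep)
    (alternatingGroup_le_range_toPermHom_rootSet_map f h4 hsep h12)

/-- **The heart of `𝔽₃^{roots f}` — i.e. the `𝔽₃[Γ_K]`-module `J_f[1 - ω]` (`picard_lambdaTorsion_iso_heart`)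
— is irreducible for generic `f`** (`12 ∣ #Gal(f/ℚ)`): transport of
`augmentationRep_rootSet_map_isIrreducible` (`k = 𝔽₃`, `2 ≠ 0`) along the equivalence
`augmentationRepEquivHeartRep` (`3 ∤ 4`).  (Absolute irreducibility: apply
`augmentationRep_rootSet_map_isIrreducible` with `k ⊇ 𝔽₃` arbitrary.)
[cite: Zarhin2018SuperellipticJacobians, §8 (i) (arXiv p. 22)] -/
theorem heartRep_rootSet_map_isIrreducible (f : ℤ[X])
    (h4 : f.natDegree = 4) (hsep : (f.map (Int.castRingHom ℚ)).Separable)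
    (h12 : 12 ∣ Nat.card (f.map (Int.castRingHom ℚ)).Gal) :
    (heartRep 3 ((f.map (algebraMap ℤ K)).rootSet (AlgebraicClosure K)) (absoluteGaloisGroup K)).IsIrreducible := by
  haveI := augmentationRep_rootSet_map_isIrreducible (K := K) f h4 hsep h12 (k := ZMod 3) (by decide)
  exact Literature.RepresentationTheory.Semisimple.Representation.isIrreducible_of_equiv
    (V := augmentationSubmodule (ZMod 3) ((f.map (algebraMap ℤ K)).rootSet (AlgebraicClosure K)))
    (ρ := augmentationRep (ZMod 3) (absoluteGaloisGroup K) ((f.map (algebraMap ℤ K)).rootSet (AlgebraicClosure K)))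
    (augmentationRepEquivHeartRep 3 ((f.map (algebraMap ℤ K)).rootSet (AlgebraicClosure K))
      (not_three_dvd_card_rootSet K h4 hsep) (absoluteGaloisGroup K))

end PicardHeartIrreducible

/-! ## The `3`-adic Tate module of the Jacobian of the Picard curve as a continuous `Γ_K`-representation -/

section PicardTateModule

open Literature.NumberTheory.EllipticCurves

variable (K : Type*) [Field K] [CharZero K] [IsCyclotomicExtension {3} ℚ K]

/-- `Pic(C_{f,K̄})` of the Picard curve is a discrete `Γ_K`-module. [folklore] -/
theorem picard_continuousSMul_geomPic {f : ℤ[X]} (h4 : f.natDegree = 4)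
    (hsep : (f.map (Int.castRingHom ℚ)).Separable) :
    haveI := fact_irreducible_superellipticPoly_picard K h4 hsep
    ContinuousSMul (absoluteGaloisGroup K) (GeomPic K 3 (f.map (algebraMap ℤ K))) := by
  haveI := fact_irreducible_superellipticPoly_picard K h4 hsep
  exact continuousSMul_absoluteGaloisGroup_geomPic K 3 (f.map (algebraMap ℤ K))
    (exists_isPrimitiveRoot_three_of_isCyclotomicExtension K) (separable_map_algebraMap_int K hsep)

/-- **`T₃ J(C_f)` for the Picard curve `y³ = f(x)` as a continuous Galois representation of `Γ_K`,
`K ⊇ ℚ(ω)`** — the object whose `ω`-eigenparts (after `⊗ ℚ̄₃` and a frame) are the `ρ` of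
`picardCurve_exists_lambdaAdicRep`; rank, unramifiedness and Frobenius traces are NOT established here.
[cite: SerreTate1968GoodReduction, Thm. 1] -/
noncomputable def picardTateGaloisRep (f : ℤ[X]) (h4 : f.natDegree = 4) (hsep : (f.map (Int.castRingHom ℚ)).Separable) :
    haveI := fact_irreducible_superellipticPoly_picard K h4 hsep
    GaloisRep K ℤ_[3] (TateModule (GeomPic K 3 (f.map (algebraMap ℤ K))) 3) :=
  haveI := fact_irreducible_superellipticPoly_picard K h4 hsep
  superellipticTateGaloisRep K 3 (f.map (algebraMap ℤ K))
    (exists_isPrimitiveRoot_three_of_isCyclotomicExtension K) (separable_map_algebraMap_int K hsep) 3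

/-- The deck transformation `y ↦ ω y` commutes with `Γ_K` on `T₃ J(C_f)` (the `ℤ₃[ω]`-structure is
`Γ_K`-linear). [cite: Zarhin2018SuperellipticJacobians, §8] -/
theorem picard_smul_deck_smul_tateModule {f : ℤ[X]} (h4 : f.natDegree = 4)
    (hsep : (f.map (Int.castRingHom ℚ)).Separable) :
    haveI := fact_irreducible_superellipticPoly_picard K h4 hsep
    ∀ (σ : absoluteGaloisGroup K) (ζ : CyclicCoverDeck (AlgebraicClosure K) 3)
      (a : TateModule (GeomPic K 3 (f.map (algebraMap ℤ K))) 3), σ • (ζ • a) = ζ • (σ • a) := by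
  haveI := fact_irreducible_superellipticPoly_picard K h4 hsep
  exact absoluteGaloisGroup_smul_deck_smul_tateModule K 3 (f.map (algebraMap ℤ K))
    (exists_isPrimitiveRoot_three_of_isCyclotomicExtension K) 3

end PicardTateModule

end Literature.NumberTheory.GaloisRepresentations
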